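import Summits.QuantumFields.YangMills.Theorems.BalabanUVNodesN08Thm2AtRecordFromAlpha
import Summits.QuantumFields.YangMills.Theorems.BalabanUVNodesN08Thm2AtRecordTransplantAC
import Summits.QuantumFields.Balaban3D.Proofs.Thm2AC
import Summits.QuantumFields.Balaban3D.Proofs.Bound46AC

/-!
# BalabanUVNodes ∕ N08 — THE LOAD POINT OF E6′: the [Balaban1985UV3] SLOT OF RECORD `Node00.PrintedUV3V N L` (Thm 1 compact ∧ Thm 2, print's ∃-prefix, AT PRINT'S
# OWN AVERAGING) FROM THE d = 3 LANE'S (α)-AC ROWS `AlphaAC.RunAlphaAC` — NO exact Haar compatibility anywhere — MODULO THE ONE THEOREM-1 ROW THAT CONSUMES IT: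
# the large-field control B25 (pp. 273–274) READ AT THE AC TOWER

Track A, DAG node N08 = T. Bałaban, CMP **102** (1985) 255–275 [Balaban1985UV3]: Thm 1 p. 257 (bounds (5)), Thm 2 p. 272 ((41) p. 266, (47) p. 267), the leaves
(22)–(36) pp. 261–265 ∕ (55)–(62) pp. 269–272, (46) p. 267, (65)–(71) pp. 273–274; print's averaging (2) = [Balaban1985Averaging] (15) p. 19; [7] =
[Balaban1985Variational].  Cell `pub-ymgap`, width seat `pub-ymgap-dag-n08-w1` (g3), W-SEAT-START-LIST §n08 item 1 successor piece (o8) = file 14; `--supports` K1⁷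
`StabilityBAtRecordR13SepCoPH` (helper).  Companion of file 13 `…N08Thm2AtRecordFromAlpha` (§4∕§5: the slot of record from E6′ + the lane's (α) inputs `RunAlpha`) and of
file 12 `…TransplantAC` (Thm 2 as printed from the (α)-AC rows, no E6′).

WHY (located, after n08-w3 g3's `…HaarCompatibilityGuardReparamDefect` ∕ `…GuardMixture`: E6′ — `(avOfPrint N S j)_*(dU) = dV` — is fibrewise FALSE and globally a
cancellation question of size ≲ 10⁻⁴⁸ per plaquette, undecidable here).  In the d = 3 lane exact Haar compatibility `Carriers.ExternalInputs.av_map` is consumed by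
THEOREM 1 ONLY through the history-mass bound `Carriers.HistWeights.mass_le_one` inside the large-field resummation of pp. 273–274 (`Run3LargeField.lf_dominated_adm` →
the leaf B25 `B10Assembly.LeafSystem.lf`); THEOREM 2 never reads it (lane module `Proofs.TowerAC`, docstring).  The AC lane (`StandardAC.ExternalInputsAC`: `Ū` measurable
with `Ū_*(dU) ≪ dV` only; masses = the exact Radon–Nikodym transports, uncapped) re-types EVERY OTHER leaf of the 4D cell's 25-field `LeafSystem`: the fourteen step leaves
(`Thm2AC.stepLeavesOfAC ∘ stepResidualsAC_of_alpha`), (46) (`Bound46AC.abs_pint_le_stdAC`), B20∕B21 (`AlphaAdaptersAC`), (1)₀ (`Thm2AC.step0_towerOfAC`), (43)@0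
(`InputsAC.noInteraction0_towerOfAC`), the slot (`InputsAC.specOK_towerOfAC`).  This file knits them AT THE RECORD'S BINDERS.

WHAT THIS FILE PROVES (kernel; theorems only, 0 def; nothing of the paper asserted).  For AC external inputs `X S : StandardAC.ExternalInputsAC S (SU N)` whose
[7]-minimisers above level 0 are the record's (`(X S).Uk k = UkA … (k+1) εbg` along `𝔞_X`), expansion data `𝔖`, (α)-AC data `𝔄`, and `c⋆ = (eps0Of γ₀, Σ_{j<K}E^{(j)}, lane
b₀, p₀, εbg)`:
* §1 `exists_transplant_towerAC3` — file 11's transplant `exists_transplant` for a family of AC tower inputs `TowerAC.TowerInputAC`, KEEPING the leaf-system clause (file 12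
  dropped it): tower objects EXTENDING `runObjects₀A N 𝔞_D 𝔗_D (Backgrounds.ofAvg N L 𝔞_D) c S` on the nose, (41)∕(47) above level 0 the AC tower's, k = 0 data print's, every
  `LeafSystem C` on the AC tower inherited once (41)₀ ∧ (47)₀ hold; `usesConsts_inputOfAC` — the lane's AC tower USES the record's constants (`EndTheorem.UsesConsts`).
* §2 ★★ `bound46_towerOfAC_of_alphaAC` — row B15 ((46) p. 267) IN `UVStability3D.AnalyticLeaves` SHAPE AT THE AC TOWER `towerOfAC 𝔠.lane X 𝔖` from the (α)-AC rows on
  the `≤`-family (`Bound46AC.abs_pint_le_stdAC` + the volume identification R-LAMVOL); ★★ `nonempty_analyticLeaves_towerOfAC_of_alphaAC_of_lf` — **THE WHOLE ANALYTIC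
  BUNDLE `UVStability3D.AnalyticLeaves 𝔠.lane.consts S (towerOfAC 𝔠.lane X 𝔖)` from `RunAlphaAC` and ONE MORE HYPOTHESIS `hlf`** = the text of `AnalyticLeaves.lf` (the
  large-field control (67)–(71) + [9] §3.C, constant `d`) read at the AC tower.
* §3 ★★★ `printedUV3G_of_analyticLeaves_towerAC3_of_window` (generic AC inputs) and **`printedUV3V_at_slotOfRecord_of_alphaAC_of_lf_of_window` ∕ `…_of_consts` — THE SLOT
  OF RECORD `Node00.PrintedUV3V N L` ITSELF for AC inputs AT PRINT'S OWN AVERAGING (`(X S).av = avOfPrint N S`) from `RunAlphaAC` + `hlf` on the family, given the window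
  (resp. only `b₀p₀^{p₀}e^{1−p₀} ≤ εbg`) — NO E6′**; `…_of_consts'` the A6 form along file 9 §2's inhabitant `exists_externalInputsAC_ofPrint` (the print-averaging AC
  inputs pinned to the record EXIST: the antecedent's DATA side is inhabited; the Prop rows `RunAlphaAC` ∧ `hlf` are N08's object gap in AC currency, LOCATED); the PRIMED
  slot `PrintedUV3V'` along any admissible AC averaging likewise (`printedUV3V'_at_record_of_alphaAC_of_lf_of_consts`).

LOCATED READING (count-neutral; the owners — plan ∕ node00-def ∕ pub-balaban — decide): (R4‴) `Node00.PrintedUV3V N L` ⟸ RunAlphaAC(print-averaging AC inputs pinned to the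
record above level 0) ∧ B25 read at the AC tower ∧ `b₀p₀^{p₀}e^{1−p₀} ≤ εbg`.  E6′'s ENTIRE load in N08 is the step `mass ≤ 1` of pp. 273–274's resummation; at print's
averaging the masses are the exact transports (local Jacobians of `Ū` inside), so what the slot asks of [Balaban1985Averaging] (15) is an EXTENSIVE large-field∕Jacobian bound
(the shape of (5) itself), not the exact identity (10).  Whether `hlf` holds at the record's `d = 6∕log L` for print's averaging is NOT claimed here.

HONEST FRAMING: count-neutral helper; N08 NOT discharged — the (α)-AC rows (the GAP binders G3D-01…08 «as cited», the displays (26), (28), (44), (67), (68), the residual rows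
R3D-01∕02, at the AC objects) and `hlf` are HYPOTHESES whose joint satisfiability at inputs pinned to the record is the open programme = N08's object gap; `PrintedUV3V` NOT
proved; one finite 𝕋⁴ programme at fixed ε, Bałaban AS PRINTED (d = 3 tori of [B10] inside the record) — R4 closes the conditional finite-𝕋⁴ rung `BalabanLadder.UV` only; the
Yang–Mills mass gap (Clay) is NOT proved by any of this; nothing continuum ∕ ℝ⁴ ∕ OS.  No `sorry`, standard axioms.
-/

noncomputable section

namespace Summit.QuantumFields.YangMills.BalabanUVNodes.N08SlotOfRecordFromAlphaAC

open Metric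
open Literature.MathematicalPhysics.QuantumFieldTheory.Balaban1983to89
open Literature.MathematicalPhysics.QuantumFieldTheory.Balaban1983to89.B10 (Ineq41 Ineq47 TowerRun pFun Bound25Printed)
open Literature.MathematicalPhysics.QuantumFieldTheory.Balaban1983to89.B10SectAGathering (StepLeaves StepPieces)
open Literature.MathematicalPhysics.QuantumFieldTheory.Balaban1983to89.TreeLengthTorus (tsys)
open Literature.MathematicalPhysics.QuantumFieldTheory.Balaban1983to89.Node00 (SU TFamily₃)
open Literature.MathematicalPhysics.QuantumFieldTheory.Balaban1983to89.B10RunsOfRecord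
open Literature.MathematicalPhysics.QuantumFieldTheory.Balaban1985CMP102
open Literature.MathematicalPhysics.QuantumFieldTheory.Balaban1985CMP102.Setting
open Literature.MathematicalPhysics.QuantumFieldTheory.Balaban1985CMP102.Theorems (Family)
open Summit.QuantumFields.Balaban3D
open Summit.QuantumFields.Balaban3D.Carriers (nblkOf StepSeries LamFin LamVol rcolOf LamVol_succ_eq_card_lamFin)
open Summit.QuantumFields.Balaban3D.Proofs
open Summit.QuantumFields.Balaban3D.Proofs.ScalesArithmetic
open Summit.QuantumFields.Balaban3D.Proofs.GroupModelLieC (lieC)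
open Summit.QuantumFields.Balaban3D.Proofs.Constants (eps0Of)
open Summit.QuantumFields.Balaban3D.Proofs.FamilyLE (le_of_eps0Of thresholds_of_le)
open Summit.QuantumFields.Balaban3D.Proofs.TowerAC (TowerInputAC)
open Summit.QuantumFields.Balaban3D.Proofs.StandardAC (ExternalInputsAC)
open Summit.QuantumFields.Balaban3D.Proofs.InputsAC (inputOfAC towerOfAC piecesAC noInteraction0_towerOfAC)
open Summit.QuantumFields.Balaban3D.Proofs.AlphaAC (AlphaDataAC RunAlphaAC)
open Summit.QuantumFields.Balaban3D.Proofs.AlphaAdaptersAC (logZT_le_piecesAC pprT_le_piecesAC)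
open Summit.QuantumFields.Balaban3D.Proofs.Thm2AC (stepLeavesOfAC stepResidualsAC_of_alpha step0_towerOfAC)
open Summit.QuantumFields.YangMills.BalabanUVNodes.N08Thm2AtRecordLevelZero
open Summit.QuantumFields.YangMills.BalabanUVNodes.N08Thm2AtRecordSeamK0
open Summit.QuantumFields.YangMills.BalabanUVNodes.N08Thm2AsPrintedAtSlotOfRecordAC
open Summit.QuantumFields.YangMills.BalabanUVNodes.N08Thm2AtRecordTransplant
open Summit.QuantumFields.YangMills.BalabanUVNodes.N08Thm2AtRecordFromAlpha (window_of_famConsts pos_of_famConsts consts_adm_of_pos)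

/-! ## §1 The transplant for AC tower inputs, keeping the leaf-system clause; the AC tower uses the record's constants -/
section Transplant

variable {N : ℕ} [NeZero N] {L : ℕ}

/-- ★ **FILE 11's TRANSPLANT FOR A FAMILY OF AC TOWER INPUTS, LEAF-SYSTEM CLAUSE KEPT** (file 12's `thm2_asPrinted_at_record_binders_of_window` discarded it): for AC tower
inputs `D S : TowerAC.TowerInputAC S (SU N)` pinned to the record above level 0 (`ε₁ = ε₁(c)`, `U_k = UkA … (k+1) εbg` along `𝔞_D`, `Σ_{j<K}E^{(j)} = c.E`) there are
tower objects EXTENDING `runObjects₀A N 𝔞_D 𝔗_D (Backgrounds.ofAvg N L 𝔞_D) c S` ON THE NOSE whose (41)∕(47) above level 0 are the AC tower's, whose k = 0 data are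
print's (`Pint 0 ≡ 0` inherited, `LF 0 V F = exp (F ∅)`), and which inherit every leaf system of the AC tower once (41)₀ ∧ (47)₀ hold — any `εbg`, any classes, masses
uncapped. [cite: Balaban1985UV3, (1)–(7) pp.256–257 + (38)–(43) p.266 (the binders; bookkeeping)] -/
theorem exists_transplant_towerAC3 (D : ∀ S : Scales L, TowerInputAC S (SU N)) (c : Consts L)
    (hε₁ : ∀ (S : Scales L) k, (D S).ε₁ k = eps1OfPrint c S k)
    (hUk : ∀ (S : Scales L) k (V : GaugeField S.P (k + 1) (SU N)), (D S).Uk k V = UkA N (fun S => (D S).av) S (k + 1) c.εbg V)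
    (hE : ∀ S : Scales L, B10.Ek (D S).Estep S.K 0 = c.E S) (S : Scales L) :
    ∃ W' : SectB.TowerObjects S (SU N),
      W'.toRunObjects = runObjects₀A N (fun S => (D S).av) (fun S j => (Carriers.run3 ((D S).toRunInput fun _ => True)).T j)
        (Backgrounds.ofAvg N L fun S => (D S).av) c S ∧
      (∀ k, 1 ≤ k → ((Ineq41 W'.pin.toTowerRun k ↔ Ineq41 (D S).tower3.toTowerRun k) ∧ (Ineq47 W'.pin.toTowerRun k ↔ Ineq47 (D S).tower3.toTowerRun k))) ∧
      ((∀ (h : Carriers.Hist S.P 0) (V : GaugeField S.P 0 (SU N)), (D S).Pint 0 h V = 0) → ∀ (h : W'.Hist 0) (V : GaugeField S.P 0 (SU N)), W'.Pint 0 h V = 0) ∧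
      (∀ (V : GaugeField S.P 0 (SU N)) (F : W'.Hist 0 → ℝ), W'.LF 0 V F = Real.exp (F (W'.triv 0))) ∧
      (∀ C : B10Assembly.Consts, B10Assembly.LeafSystem C (D S).tower3.toTowerRun → B10.Step0Printed W'.pin.toTowerRun →
        Nonempty (B10Assembly.LeafSystem C W'.pin.toTowerRun)) := by
  refine exists_transplant ((D S).towerWith fun _ => True) _ (fun k V => ?_) (hE S).symm (fun k => (hε₁ S k).symm) (fun k U => ?_)
    (fun V F => TowerAC.TowerInputAC.towerWith_lf_zero _ _ V F)
  · show UkA N (fun S => (D S).av) S (k + 1) c.εbg V = (Carriers.run3 ((D S).toRunInput fun _ => True)).Uk (k + 1) V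
    rw [TowerAC.TowerInputAC.ukAll_eq]
    exact (hUk S k V).symm
  · exact congrFun (rho_congr
      (runObjects₀A N (fun S => (D S).av) (fun S j => (Carriers.run3 ((D S).toRunInput fun _ => True)).T j)
        (Backgrounds.ofAvg N L fun S => (D S).av) c S)
      ((D S).towerWith fun _ => True).toRunObjects rfl HEq.rfl (hE S).symm k) U

/-- **THE LANE'S AC TOWER USES THE RECORD'S CONSTANTS** (`EndTheorem.UsesConsts`, AC twin of `Inputs.usesConsts_inputOf`): `M₁, b₀, p₀, κ₀` by `rfl`, the remainder
profile `rcoef j = rstar·(g²)^{3+κ₀}` by `Inputs.rcoefOf_carrier`, `|Λ_k| = min(Λ-count, |T₁^{(k)}|) ≥ 0`. [cite: Balaban1985UV3, (7) p.257 + (41) p.266] -/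
theorem usesConsts_inputOfAC (𝔎 : Inputs.LaneConsts L) {S : Scales L} {G : Type} [GaugeGroup G] [MeasurableSpace G] [HaarData G]
    {V : Type} [NormedAddCommGroup V] [NormedSpace ℂ V] (X : ExternalInputsAC S G) (𝔖 : ∀ k, StepSeries S G V (nblkOf S 𝔎.carrier k) k)
    (slot : ℕ → Prop) : EndTheorem.UsesConsts 𝔎.consts ((inputOfAC 𝔎 X 𝔖).towerWith slot) where
  M₁_eq := rfl
  b₀_eq := rfl
  p₀_eq := rfl
  κ₀_eq := rfl
  rcoef_eq j := by
    show Carriers.rcoefOf S 𝔎.carrier j = _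
    exact Inputs.rcoefOf_carrier 𝔎 S j
  Λvol_nonneg k _ := le_min (Nat.cast_nonneg _) (sites_nonneg S k)

end Transplant

/-! ## §2 The analytic bundle of the end theorem AT THE AC TOWER from the (α)-AC rows, modulo the large-field row B25 -/
section Leaves

variable {L : ℕ} {S : Scales L} {G : Type} [GaugeGroup G] [MeasurableSpace G] [HaarData G] {𝔊 : GroupModel G} {𝔠 : Primitives.AlphaConsts L 𝔊.N}
  {X : ExternalInputsAC S G} {𝔖 : ∀ k, StepSeries S G ↥(lieC 𝔊) (nblkOf S 𝔠.lane.carrier k) k} {𝔄 : AlphaDataAC 𝔊 𝔠 X 𝔖}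
  (hle : S.g ^ 2 * S.ε₀ ≤ (min 𝔠.gamma0 1) ^ 2)
include hle

/-- **(25) AT THE CHART CENTRE from the (α)-AC step rows** (the vacuum activities `Re Ψ_X(0)` of (62); G3D-01's bound at `B = 0` — seat p3's `UVStability3DInputs.bound25_vac`
read at the AC rows). [cite: Balaban1985UV3, (25) p.262] -/
theorem bound25_vac_of_alphaAC (k : ℕ) (hk : k + 1 ≤ S.K) (A : AlphaAC.StepAlphaAC 𝔊 𝔠 X 𝔖 𝔄 k) :
    Bound25Printed ⟨(tsys 3 (nblkOf S 𝔠.lane.carrier k)).Dom, GaugeField S.P (k + 1) G, (tsys 3 (nblkOf S 𝔠.lane.carrier k)).dj,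
      fun Y _ => ((𝔖 k).Ψ Y 0).re⟩ (S.gk k) 𝔠.κ 𝔠.C25 := by
  have _ := hle; have _ := hk
  intro Y _
  have hρ : 0 < 𝔠.ρ := (A.chart Y).1
  exact (Complex.abs_re_le_norm _).trans ((A.chart Y).2.2 0 (mem_closedBall_self (by positivity)))

/-- ★★ **Row B15 ((46) p. 267) AT THE AC TOWER, IN `UVStability3D.AnalyticLeaves` SHAPE, FROM THE (α)-AC ROWS on the `≤`-family**: «|Σ_{j=1}^k Σ_{Y_j} 𝒫_j(Y_j, U_k)| ≤
O(1)M₁³(g_{k−1}²p(g_{k−1})²)|Λ_k|» with the record's `C46` for `towerOfAC 𝔠.lane X 𝔖` — the lane's `Bound46AC.abs_pint_le_stdAC` (old slice from (44) `h44`∕`hfloor` at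
the threshold `γ₄₆`, newborn slice from G3D-01∕(28)∕G3D-06∕`hPY`∕G3D-07∕G3D-08∕`hPYZ`) one step up, `|Ω_{k+1}^{(k+1)}(h)| = #LamFin ≤ Λvol (k+1) h` (R-LAMVOL:
`LamVol_succ_eq_card_lamFin`, `sites_eq_card`), and `C46 = A₄₆·M₁⁻³` (`rfl` on the record). [cite: Balaban1985UV3, (44)–(46) p.267 + (33)–(34) p.264 + (61) p.271] -/
theorem bound46_towerOfAC_of_alphaAC (R : RunAlphaAC 𝔊 𝔠 X 𝔖 𝔄) :
    ∀ k, 1 ≤ k → k ≤ (towerOfAC 𝔠.lane X 𝔖).K → ∀ (h : (towerOfAC 𝔠.lane X 𝔖).Hist k) (U : (towerOfAC 𝔠.lane X 𝔖).Cfg k),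
      |(towerOfAC 𝔠.lane X 𝔖).Pint k h U| ≤ 𝔠.lane.consts.C46 * (towerOfAC 𝔠.lane X 𝔖).M₁ ^ 3
        * (((towerOfAC 𝔠.lane X 𝔖).g (k - 1)) ^ 2 * (pFun (towerOfAC 𝔠.lane X 𝔖).b₀ (towerOfAC 𝔠.lane X 𝔖).p₀ ((towerOfAC 𝔠.lane X 𝔖).g (k - 1))) ^ 2)
        * (towerOfAC 𝔠.lane X 𝔖).Λvol k h := by
  have h46 := Bound46AC.abs_pint_le_stdAC X 𝔠.lane.carrier 𝔖 𝔠.C44_nonneg 𝔠.B₃_pos.le 𝔠.κ₁_pos 𝔠.lane.F.M₁_pos 𝔠.lane.F.b₀_pos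
    𝔠.lane.F.p₀_pos 𝔠.chart (κ := 𝔠.κ) (C25 := 𝔠.C25) (C63 := 𝔠.C63) (C45 := 𝔠.C45) (by linarith [𝔠.kappa_ge]) 𝔠.C25_nonneg 𝔠.C63_nonneg
    (lt_of_lt_of_le one_pos 𝔠.one_le_r₀) (fun k hk => (R.steps k hk).h44) (fun k hk => (R.steps k hk).hfloor)
    (fun k hk => (thresholds_of_le hle k (by omega)).2.1) (fun k hk => (R.steps k hk).chart) (fun k hk => (R.steps k hk).bound28)
    (fun k hk => (thresholds_of_le hle k (by omega)).2.2.2.2) (fun k hk => (R.steps k hk).far_le) (fun k hk => (R.steps k hk).hPY)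
    (fun k _ => 𝔄.Λc k) (fun k _ => 𝔄.N45 k) (fun k hk => (R.steps k hk).hPYZ)
  have hL1 : (1 : ℝ) < L := by exact_mod_cast S.hL.2
  intro k hk1 hkK h U
  obtain ⟨k, rfl⟩ : ∃ k', k = k' + 1 := ⟨k - 1, by omega⟩
  have hkK' : k + 1 ≤ S.K := hkK
  have h1 := h46 k hkK' h U
  -- the volume identification (R-LAMVOL): `#LamFin ≤ Λvol (k+1) h = min |Ω_{k+1}^{(k+1)}(h)| |T₁^{(k+1)}|`
  have h2 : ((LamFin 𝔠.lane.carrier.M₁ (rcolOf S 𝔠.lane.carrier) k h).card : ℝ) ≤ (towerOfAC 𝔠.lane X 𝔖).Λvol (k + 1) h := by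
    show ((LamFin 𝔠.lane.carrier.M₁ (rcolOf S 𝔠.lane.carrier) k h).card : ℝ) ≤
      min (LamVol 𝔠.lane.carrier.M₁ (rcolOf S 𝔠.lane.carrier) (k + 1) h : ℝ) (S.sites (k + 1))
    rw [LamVol_succ_eq_card_lamFin]
    refine le_min le_rfl ?_
    rw [sites_eq_card S (k + 1) (by omega)]
    exact_mod_cast Finset.card_le_univ _
  show |(towerOfAC 𝔠.lane X 𝔖).Pint (k + 1) h U| ≤
    𝔠.lane.consts.C46 * (𝔠.lane.carrier.M₁ : ℝ) ^ 3 * ((S.gk (k + 1 - 1)) ^ 2 * (pFun 𝔠.lane.carrier.b₀ 𝔠.lane.carrier.p₀ (S.gk (k + 1 - 1))) ^ 2) *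
      (towerOfAC 𝔠.lane X 𝔖).Λvol (k + 1) h
  rw [Nat.add_sub_cancel]
  have hC46 : 𝔠.lane.consts.C46 * (𝔠.lane.carrier.M₁ : ℝ) ^ 3 =
      2 * 𝔠.C44 * (8 * (L : ℝ) ^ 2 * 𝔠.B₃ *
          (2 / (𝔠.κ₁ / 𝔠.lane.carrier.M₁) * (24 * (48 / (𝔠.κ₁ / 𝔠.lane.carrier.M₁ / 2) ^ 3 * Real.exp (𝔠.κ₁ / 𝔠.lane.carrier.M₁ / 2 / 2) /
            (1 - Real.exp (-(𝔠.κ₁ / 𝔠.lane.carrier.M₁ / 2 / 2)))) * 1))) ^ 2 * ((L : ℝ) ^ 4 / ((L : ℝ) - 1)) +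
        Newborn46.Cnew46 L 𝔠.chart 𝔠.C25 𝔠.C63 𝔠.C45 𝔠.lane.carrier.b₀ 𝔠.lane.carrier.p₀ := by
    show (2 * 𝔠.C44 * (8 * (L : ℝ) ^ 2 * 𝔠.B₃ * 𝔠.Zfull) ^ 2 * ((L : ℝ) ^ 4 / ((L : ℝ) - 1)) + 𝔠.Cnew) * ((𝔠.M₁ : ℝ)⁻¹) ^ 3 * (𝔠.M₁ : ℝ) ^ 3 = _
    rw [mul_assoc, ← mul_pow, inv_mul_cancel₀ 𝔠.M₁_pos_real.ne', one_pow, mul_one]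
    rfl
  rw [hC46, ← mul_pow]
  have hgp : 0 ≤ (S.gk k * pFun 𝔠.lane.carrier.b₀ 𝔠.lane.carrier.p₀ (S.gk k)) ^ 2 := sq_nonneg _
  have hA : 0 ≤ 2 * 𝔠.C44 * (8 * (L : ℝ) ^ 2 * 𝔠.B₃ *
          (2 / (𝔠.κ₁ / 𝔠.lane.carrier.M₁) * (24 * (48 / (𝔠.κ₁ / 𝔠.lane.carrier.M₁ / 2) ^ 3 * Real.exp (𝔠.κ₁ / 𝔠.lane.carrier.M₁ / 2 / 2) /
            (1 - Real.exp (-(𝔠.κ₁ / 𝔠.lane.carrier.M₁ / 2 / 2)))) * 1))) ^ 2 * ((L : ℝ) ^ 4 / ((L : ℝ) - 1)) +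
        Newborn46.Cnew46 L 𝔠.chart 𝔠.C25 𝔠.C63 𝔠.C45 𝔠.lane.carrier.b₀ 𝔠.lane.carrier.p₀ := by
    have : 0 < (L : ℝ) - 1 := by linarith
    have := 𝔠.C44_nonneg
    have := 𝔠.B₃_pos.le
    have hCnew : 0 ≤ Newborn46.Cnew46 L 𝔠.chart 𝔠.C25 𝔠.C63 𝔠.C45 𝔠.lane.carrier.b₀ 𝔠.lane.carrier.p₀ := 𝔠.Cnew_nonneg
    positivity
  exact h1.trans (mul_le_mul_of_nonneg_left h2 (mul_nonneg hA hgp))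

/-- ★★ **THE ANALYTIC BUNDLE OF THE END THEOREM AT THE AC TOWER `towerOfAC 𝔠.lane X 𝔖` FROM THE (α)-AC ROWS on the `≤`-family, MODULO ROW B25** (AC twin of
`Residuals.analyticLeavesOf ∘ FamilyLE.runResiduals_of_alpha_le`): (1)₀ (`Thm2AC.step0_towerOfAC`: one history, `LF 0 V F = exp (F ∅)`, `U₀ = id`, `Pint 0 ≡ 0`), (43)@0
(`InputsAC.noInteraction0_towerOfAC`), the fourteen step leaves per `k < K` (`Thm2AC.stepLeavesOfAC ∘ stepResidualsAC_of_alpha`: C1∕C2 transported under `AvgAC` over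
the exact-transport masses, C3–C8∕C10 from the AC series leaves), B15 (`bound46_towerOfAC_of_alphaAC`), B20 (`AlphaAdaptersAC.logZT_le_piecesAC` ← G3D-05), B21
(`pprT_le_piecesAC` ← G3D-01 at the chart centre), the piece equations `starT_eq`∕`rem_eq` (`rfl`) and `logσ₀_le`∕`dg_le` (`le_rfl`), and **B25 = the hypothesis `hlf`**,
the text of `UVStability3D.AnalyticLeaves.lf` at the AC tower: the large-field control of pp. 273–274 ((67)–(71) + [9] §3.C, the family's `d`) for `LFAC` of the
UNCAPPED masses — the one leaf whose lane proof (`Run3LargeField.lf_dominated_adm`) consumes `mass ≤ 1`, i.e. exact Haar compatibility of `Ū`.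
[cite: Balaban1985UV3, pp.256–274 (the leaves) + (46) p.267 + (65) p.273 + pp.273–274] -/
theorem nonempty_analyticLeaves_towerOfAC_of_alphaAC_of_lf (R : RunAlphaAC 𝔊 𝔠 X 𝔖 𝔄)
    (hlf : ∀ k, k ≤ (towerOfAC 𝔠.lane X 𝔖).K → ∀ U : (towerOfAC 𝔠.lane X 𝔖).Cfg k,
      (towerOfAC 𝔠.lane X 𝔖).LF k U (fun h => -((towerOfAC 𝔠.lane X 𝔖).mainT k h U) + (towerOfAC 𝔠.lane X 𝔖).Zterm k h)
        ≤ Real.exp (𝔠.lane.consts.d * (towerOfAC 𝔠.lane X 𝔖).sites k)) :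
    Nonempty (UVStability3D.AnalyticLeaves 𝔠.lane.consts S (towerOfAC 𝔠.lane X 𝔖)) :=
  ⟨{ step0 := step0_towerOfAC 𝔠.lane X 𝔖
     noInt0 := noInteraction0_towerOfAC 𝔠.lane X 𝔖
     steps := fun k hk => stepLeavesOfAC k hk (stepResidualsAC_of_alpha hle k hk (R.steps k hk))
     bound46 := bound46_towerOfAC_of_alphaAC hle R
     logZT_le := fun k hk => logZT_le_piecesAC 𝔠.lane X 𝔖 k 𝔠.cT_pos rfl (R.steps k hk).logZT
     PprT_le := fun k hk => pprT_le_piecesAC 𝔠.lane X 𝔖 k hk (by linarith [𝔠.kappa_ge]) 𝔠.C25_nonneg rfl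
       (bound25_vac_of_alphaAC hle k hk (R.steps k hk))
     lf := hlf
     starT_eq := fun _ _ => rfl
     logσ₀_le := fun _ _ => le_rfl
     dg_le := fun _ _ => le_rfl
     rem_eq := fun _ _ => rfl }⟩

end Leaves

/-! ## §3 The printed pair at the record's binders along AC inputs, and THE SLOT OF RECORD at print's own averaging — no E6′ -/
section Slot

variable {N : ℕ} [NeZero N] {L : ℕ}

/-- ★★ **THE PRINTED PAIR `PrintedUV3G` AT THE RECORD'S BINDERS ALONG A FAMILY OF AC TOWER INPUTS from uniform concrete leaves on the AC towers** (AC twin of file 11's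
`printedUV3G_of_analyticLeaves_tower3_of_window`): admissible `c`, the pins `ε₁ = ε₁(c)`, `U_k = UkA … (k+1) εbg`, `Σ_{j<K}E^{(j)} = c.E`, the level-0 window
`ε₁(0)(S) ≤ εbg ∨ 2 < εbg` at every member of `Family L c.eps0`, normalised constants `C` used by the towers, and `UVStability3D.AnalyticLeaves C S (D S).tower3` on the
family ⇒ `PrintedUV3G N L (runObjects₀A N 𝔞_D 𝔗_D (Backgrounds.ofAvg N L 𝔞_D))` (§1's transplant; `UVStability3D.leafSystem_of_concrete`; file 1's (41)₀ ∕ (47)₀ at the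
record's binders; n08-a's `printedUV3G_of_uniformLeafSystems`). [cite: Balaban1985UV3, Thm 1 p.257 + Thm 2 p.272 + pp.256–274 (the leaves)] -/
theorem printedUV3G_of_analyticLeaves_towerAC3_of_window (D : ∀ S : Scales L, TowerInputAC S (SU N)) (c : Consts L) (hc : c.Adm)
    (hε₁ : ∀ (S : Scales L) k, (D S).ε₁ k = eps1OfPrint c S k)
    (hUk : ∀ (S : Scales L) k (V : GaugeField S.P (k + 1) (SU N)), (D S).Uk k V = UkA N (fun S => (D S).av) S (k + 1) c.εbg V)
    (hE : ∀ S : Scales L, B10.Ek (D S).Estep S.K 0 = c.E S)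
    (hwin : ∀ S : Family L c.eps0, eps1OfPrint c S.1 0 ≤ c.εbg ∨ 2 < c.εbg)
    {C : B10Assembly.Consts} (hC : Constants.NormalisedConsts L C)
    (hUC : ∀ S : Family L c.eps0, EndTheorem.UsesConsts C ((D S.1).towerWith fun _ => True))
    (A : ∀ S : Family L c.eps0, Nonempty (UVStability3D.AnalyticLeaves C S.1 (D S.1).tower3.toTowerRun)) :
    PrintedUV3G N L (runObjects₀A N (fun S => (D S).av) (fun S j => (Carriers.run3 ((D S).toRunInput fun _ => True)).T j)
      (Backgrounds.ofAvg N L fun S => (D S).av)) := by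
  refine printedUV3G_of_uniformLeafSystems N L _ ⟨c, hc, C, fun S => ?_⟩
  obtain ⟨W', hW', -, hP0, hLF, hLS⟩ := exists_transplant_towerAC3 D c hε₁ hUk hE S.1
  obtain ⟨A'⟩ := A S
  have LS : B10Assembly.LeafSystem C (D S.1).tower3.toTowerRun :=
    UVStability3D.leafSystem_of_concrete hC ⟨EndTheorem.carrierEqs_pin _ (hUC S), A'⟩
  have hP0' : ∀ (h : W'.Hist 0) (V : GaugeField S.1.P 0 (SU N)), W'.Pint 0 h V = 0 := hP0 fun h V => LS.noInt0 h V
  have hstep0 : B10.Step0Printed W'.pin.toTowerRun :=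
    ⟨ineq41_zero hW' hP0' fun V F => (hLF V F).symm.le,
      ineq47_zero_of_window hW' hP0' fun V hV => (hwin S).elim
        (fun h => (plaqSmall_eta_zero_iff N S.1 c.εbg V).2 (plaqSmall_mono h hV)) (fun h => plaqSmall_level_zero_of_two_lt N S.1 h V)⟩
  exact ⟨W', hW', hLS C LS hstep0⟩

variable {𝔊 : GroupModel (SU N)} {𝔠 : Primitives.AlphaConsts L 𝔊.N} {εbg : ℝ}
  {X : ∀ S : Scales L, ExternalInputsAC S (SU N)}
  {𝔖 : ∀ (S : Scales L) (k : ℕ), StepSeries S (SU N) ↥(lieC 𝔊) (nblkOf S 𝔠.lane.carrier k) k}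
  {𝔄 : ∀ S : Scales L, AlphaDataAC 𝔊 𝔠 (X S) (𝔖 S)}

/-- ★★★ **THE PRINTED PAIR AT THE RECORD'S BINDERS FROM THE (α)-AC ROWS + B25-at-the-AC-tower, GIVEN THE WINDOW** (AC external inputs with the record's minimisers above
level 0; `εbg > 0`; the window at every member of `Family L c⋆.eps0`; ONE `C = 𝔠.lane.consts` for the family — Thm 1's «O(1) independent of ε, k»): `PrintedUV3G N L` for the
binders along `𝔞_X` — NO exact Haar compatibility of `Ū` anywhere. [cite: Balaban1985UV3, Thm 1 p.257 + Thm 2 p.272 + pp.256–274] -/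
theorem printedUV3G_at_record_of_alphaAC_of_lf_of_window
    (hUk : ∀ (S : Scales L) k (V : GaugeField S.P (k + 1) (SU N)), (X S).Uk k V = UkA N (fun S => (X S).av) S (k + 1) εbg V) (hpos : 0 < εbg)
    (hwin : ∀ S : Family L (eps0Of 𝔠.gamma0), eps1OfPrint
        { eps0 := eps0Of 𝔠.gamma0, E := fun S => B10.Ek (inputOfAC 𝔠.lane (X S) (𝔖 S)).Estep S.K 0,
          b₀ := 𝔠.lane.F.b₀, p₀ := 𝔠.lane.F.p₀, εbg := εbg } S.1 0 ≤ εbg ∨ 2 < εbg)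
    (R : ∀ S : Family L (eps0Of 𝔠.gamma0), RunAlphaAC 𝔊 𝔠 (X S.1) (𝔖 S.1) (𝔄 S.1))
    (hlf : ∀ S : Family L (eps0Of 𝔠.gamma0), ∀ k, k ≤ (towerOfAC 𝔠.lane (X S.1) (𝔖 S.1)).K → ∀ U : (towerOfAC 𝔠.lane (X S.1) (𝔖 S.1)).Cfg k,
      (towerOfAC 𝔠.lane (X S.1) (𝔖 S.1)).LF k U
          (fun h => -((towerOfAC 𝔠.lane (X S.1) (𝔖 S.1)).mainT k h U) + (towerOfAC 𝔠.lane (X S.1) (𝔖 S.1)).Zterm k h)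
        ≤ Real.exp (𝔠.lane.consts.d * (towerOfAC 𝔠.lane (X S.1) (𝔖 S.1)).sites k)) :
    PrintedUV3G N L (runObjects₀A N (fun S => (X S).av)
      (fun S j => (Carriers.run3 ((inputOfAC 𝔠.lane (X S) (𝔖 S)).toRunInput fun _ => True)).T j) (Backgrounds.ofAvg N L fun S => (X S).av)) :=
  printedUV3G_of_analyticLeaves_towerAC3_of_window (fun S => inputOfAC 𝔠.lane (X S) (𝔖 S))
    { eps0 := eps0Of 𝔠.gamma0, E := fun S => B10.Ek (inputOfAC 𝔠.lane (X S) (𝔖 S)).Estep S.K 0,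
      b₀ := 𝔠.lane.F.b₀, p₀ := 𝔠.lane.F.p₀, εbg := εbg }
    (consts_adm_of_pos 𝔠 hpos _) (fun _ _ => rfl) (fun S k V => hUk S k V) (fun _ => rfl) hwin 𝔠.lane.normalised
    (fun S => usesConsts_inputOfAC 𝔠.lane (X S.1) (𝔖 S.1) fun _ => True)
    (fun S => nonempty_analyticLeaves_towerOfAC_of_alphaAC_of_lf (le_of_eps0Of S.1 S.2) (R S) (hlf S))

/-- ★★★ **THE SLOT OF RECORD `Node00.PrintedUV3V N L` FROM THE (α)-AC ROWS + B25-at-the-AC-tower, GIVEN THE WINDOW — AC inputs AT PRINT'S OWN AVERAGING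
(`(X S).av = avOfPrint N S`), NO E6′**: file 9 §1's transfer `exists_TFamily₃_of_av_eq` supplies the version `𝔗` of (2) along print's (15).
[cite: Balaban1985UV3, Thm 1 p.257 + Thm 2 p.272 + pp.256–274; Balaban1985Averaging, (15) p.19] -/
theorem printedUV3V_at_slotOfRecord_of_alphaAC_of_lf_of_window (hav : ∀ S, (X S).av = avOfPrint N S)
    (hUk : ∀ (S : Scales L) k (V : GaugeField S.P (k + 1) (SU N)), (X S).Uk k V = UkA N (fun S => (X S).av) S (k + 1) εbg V) (hpos : 0 < εbg)
    (hwin : ∀ S : Family L (eps0Of 𝔠.gamma0), eps1OfPrint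
        { eps0 := eps0Of 𝔠.gamma0, E := fun S => B10.Ek (inputOfAC 𝔠.lane (X S) (𝔖 S)).Estep S.K 0,
          b₀ := 𝔠.lane.F.b₀, p₀ := 𝔠.lane.F.p₀, εbg := εbg } S.1 0 ≤ εbg ∨ 2 < εbg)
    (R : ∀ S : Family L (eps0Of 𝔠.gamma0), RunAlphaAC 𝔊 𝔠 (X S.1) (𝔖 S.1) (𝔄 S.1))
    (hlf : ∀ S : Family L (eps0Of 𝔠.gamma0), ∀ k, k ≤ (towerOfAC 𝔠.lane (X S.1) (𝔖 S.1)).K → ∀ U : (towerOfAC 𝔠.lane (X S.1) (𝔖 S.1)).Cfg k,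
      (towerOfAC 𝔠.lane (X S.1) (𝔖 S.1)).LF k U
          (fun h => -((towerOfAC 𝔠.lane (X S.1) (𝔖 S.1)).mainT k h U) + (towerOfAC 𝔠.lane (X S.1) (𝔖 S.1)).Zterm k h)
        ≤ Real.exp (𝔠.lane.consts.d * (towerOfAC 𝔠.lane (X S.1) (𝔖 S.1)).sites k)) :
    Node00.PrintedUV3V N L := by
  obtain ⟨𝔗', h'⟩ := exists_TFamily₃_of_av_eq (N := N) (funext hav)
    (fun S j => (Carriers.run3 ((inputOfAC 𝔠.lane (X S) (𝔖 S)).toRunInput fun _ => True)).T j)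
  have hR : runObjects₀A N (fun S => (X S).av) (fun S j => (Carriers.run3 ((inputOfAC 𝔠.lane (X S) (𝔖 S)).toRunInput fun _ => True)).T j)
      (Backgrounds.ofAvg N L fun S => (X S).av) = runObjects₀T N 𝔗' (Backgrounds.ofPrint N L) :=
    funext fun c => funext fun S => h' c S
  exact ⟨𝔗', hR ▸ printedUV3G_at_record_of_alphaAC_of_lf_of_window (𝔄 := 𝔄) hUk hpos hwin R hlf⟩

/-- ★★★ **THE SLOT OF RECORD FROM THE (α)-AC ROWS + B25-at-the-AC-tower, `b₀p₀^{p₀}e^{1−p₀} ≤ εbg`** (file 13 §5: the crude bound `ε₁(0) = g₀p(g₀) ≤ b₀p₀^{p₀}e^{1−p₀}`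
gives the window at EVERY lattice approximation; no condition on `γ₀`): AC inputs at print's own averaging pinned to the record, NO E6′.
[cite: Balaban1985UV3, Thm 1 p.257 + Thm 2 p.272 + (7) p.257; Balaban1985Averaging, (15) p.19] -/
theorem printedUV3V_at_slotOfRecord_of_alphaAC_of_lf_of_consts (hav : ∀ S, (X S).av = avOfPrint N S)
    (hUk : ∀ (S : Scales L) k (V : GaugeField S.P (k + 1) (SU N)), (X S).Uk k V = UkA N (fun S => (X S).av) S (k + 1) εbg V)
    (hε : 𝔠.lane.F.b₀ * (𝔠.lane.F.p₀ ^ 𝔠.lane.F.p₀ * Real.exp (1 - 𝔠.lane.F.p₀)) ≤ εbg)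
    (R : ∀ S : Family L (eps0Of 𝔠.gamma0), RunAlphaAC 𝔊 𝔠 (X S.1) (𝔖 S.1) (𝔄 S.1))
    (hlf : ∀ S : Family L (eps0Of 𝔠.gamma0), ∀ k, k ≤ (towerOfAC 𝔠.lane (X S.1) (𝔖 S.1)).K → ∀ U : (towerOfAC 𝔠.lane (X S.1) (𝔖 S.1)).Cfg k,
      (towerOfAC 𝔠.lane (X S.1) (𝔖 S.1)).LF k U
          (fun h => -((towerOfAC 𝔠.lane (X S.1) (𝔖 S.1)).mainT k h U) + (towerOfAC 𝔠.lane (X S.1) (𝔖 S.1)).Zterm k h)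
        ≤ Real.exp (𝔠.lane.consts.d * (towerOfAC 𝔠.lane (X S.1) (𝔖 S.1)).sites k)) :
    Node00.PrintedUV3V N L :=
  printedUV3V_at_slotOfRecord_of_alphaAC_of_lf_of_window (𝔄 := 𝔄) hav hUk (pos_of_famConsts hε) (fun S => window_of_famConsts hε _ S.1) R hlf

/-- ★★ **THE PRIMED SLOT `Node00.PrintedUV3V' N L` FROM THE (α)-AC ROWS + B25-at-the-AC-tower along an ADMISSIBLE AC averaging, `b₀p₀^{p₀}e^{1−p₀} ≤ εbg`**: the AC twin of
file 13 §5's `printedUV3V'_at_record_of_runAlpha_of_consts` (there the lane's Haar-compatible averaging; here ANY averaging of print's axiomatic class with `AvgAC`).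
[cite: Balaban1985UV3, Thm 1 p.257 + Thm 2 p.272; Balaban1987RG1, (0.4)–(0.9) p.253] -/
theorem printedUV3V'_at_record_of_alphaAC_of_lf_of_consts (h𝔞 : Node00.AvgAdmissible₃ N fun S => (X S).av)
    (hUk : ∀ (S : Scales L) k (V : GaugeField S.P (k + 1) (SU N)), (X S).Uk k V = UkA N (fun S => (X S).av) S (k + 1) εbg V)
    (hε : 𝔠.lane.F.b₀ * (𝔠.lane.F.p₀ ^ 𝔠.lane.F.p₀ * Real.exp (1 - 𝔠.lane.F.p₀)) ≤ εbg)
    (R : ∀ S : Family L (eps0Of 𝔠.gamma0), RunAlphaAC 𝔊 𝔠 (X S.1) (𝔖 S.1) (𝔄 S.1))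
    (hlf : ∀ S : Family L (eps0Of 𝔠.gamma0), ∀ k, k ≤ (towerOfAC 𝔠.lane (X S.1) (𝔖 S.1)).K → ∀ U : (towerOfAC 𝔠.lane (X S.1) (𝔖 S.1)).Cfg k,
      (towerOfAC 𝔠.lane (X S.1) (𝔖 S.1)).LF k U
          (fun h => -((towerOfAC 𝔠.lane (X S.1) (𝔖 S.1)).mainT k h U) + (towerOfAC 𝔠.lane (X S.1) (𝔖 S.1)).Zterm k h)
        ≤ Real.exp (𝔠.lane.consts.d * (towerOfAC 𝔠.lane (X S.1) (𝔖 S.1)).sites k)) :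
    Node00.PrintedUV3V' N L :=
  ⟨fun S => (X S).av, h𝔞, fun S j => (Carriers.run3 ((inputOfAC 𝔠.lane (X S) (𝔖 S)).toRunInput fun _ => True)).T j,
    printedUV3G_at_record_of_alphaAC_of_lf_of_window (𝔄 := 𝔄) hUk (pos_of_famConsts hε) (fun S => window_of_famConsts hε _ S.1) R hlf⟩

variable (N L) in
/-- ★★★ **THE SLOT OF RECORD FROM ITS AC RESIDUALS — A6 FORM ALONG FILE 9 §2's INHABITANT** (`exists_externalInputsAC_ofPrint`: AC external inputs AT PRINT'S AVERAGING with the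
record's classes and minimisers EXIST for every `εbg`, `AvgAC` of (15) a theorem): for every group `SU(N)`, constants `𝔠`, radius `εbg` with `b₀p₀^{p₀}e^{1−p₀} ≤ εbg`, THERE ARE
such inputs `X`, and for every expansion data `𝔖` and (α)-AC data `𝔄` over them, **the (α)-AC rows + B25-at-the-AC-tower on the family ⇒ `Node00.PrintedUV3V N L`**.  What a
supplier reads: «produce `RunAlphaAC` and the large-field control at `towerOfAC 𝔠.lane (X S) (𝔖 S)` for THESE print-averaging inputs, uniformly on `Family L (eps0Of γ₀)`» — no
E6′, no `εbg > 2`, no regime condition on `γ₀`. [cite: Balaban1985UV3, Thm 1 p.257 + Thm 2 p.272 + pp.256–274; Balaban1985Averaging, (15) p.19] -/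
theorem printedUV3V_at_slotOfRecord_of_alphaAC_of_lf_of_consts' (𝔊 : GroupModel (SU N)) (𝔠 : Primitives.AlphaConsts L 𝔊.N) (εbg : ℝ)
    (hε : 𝔠.lane.F.b₀ * (𝔠.lane.F.p₀ ^ 𝔠.lane.F.p₀ * Real.exp (1 - 𝔠.lane.F.p₀)) ≤ εbg) :
    ∃ X : ∀ S : Scales L, ExternalInputsAC S (SU N), (∀ S, (X S).av = avOfPrint N S) ∧
      ∀ (𝔖 : ∀ (S : Scales L) (k : ℕ), StepSeries S (SU N) ↥(lieC 𝔊) (nblkOf S 𝔠.lane.carrier k) k)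
        (𝔄 : ∀ S : Scales L, AlphaDataAC 𝔊 𝔠 (X S) (𝔖 S)),
        (∀ S : Family L (eps0Of 𝔠.gamma0), RunAlphaAC 𝔊 𝔠 (X S.1) (𝔖 S.1) (𝔄 S.1)) →
        (∀ S : Family L (eps0Of 𝔠.gamma0), ∀ k, k ≤ (towerOfAC 𝔠.lane (X S.1) (𝔖 S.1)).K → ∀ U : (towerOfAC 𝔠.lane (X S.1) (𝔖 S.1)).Cfg k,
          (towerOfAC 𝔠.lane (X S.1) (𝔖 S.1)).LF k U
              (fun h => -((towerOfAC 𝔠.lane (X S.1) (𝔖 S.1)).mainT k h U) + (towerOfAC 𝔠.lane (X S.1) (𝔖 S.1)).Zterm k h)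
            ≤ Real.exp (𝔠.lane.consts.d * (towerOfAC 𝔠.lane (X S.1) (𝔖 S.1)).sites k)) →
        Node00.PrintedUV3V N L := by
  obtain ⟨X, hav, -, hUk⟩ := exists_externalInputsAC_ofPrint N L εbg
  exact ⟨X, hav, fun 𝔖 𝔄 R hlf => printedUV3V_at_slotOfRecord_of_alphaAC_of_lf_of_consts (𝔄 := 𝔄) hav hUk hε R hlf⟩

end Slot

end Summit.QuantumFields.YangMills.BalabanUVNodes.N08SlotOfRecordFromAlphaAC

end
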